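import Summits.QuantumFields.YangMills.Theorems.BalabanUVNodesN15KingModelCurvedHTorus
import Summits.QuantumFields.YangMills.Theorems.BalabanUVNodesN15KingModelFullPropagatorProfile
import Summits.QuantumFields.YangMills.Theorems.BalabanUVNodesN18KingModelScalesPair
import Literature.MathematicalPhysics.QuantumFieldTheory.King1986.MinimizerHolderRateUniform

/-!
# BalabanUVNodes ∕ N15 — THE KING-MODEL RUNG, PART 51: KING's PROPOSITION 3.8 (3.71), ALL FOUR LINES, FOR THE `A = 0` MINIMISERS ON
# BAŁABAN's VOLUMES, IN THE SCHEMA's LETTERS WITH THE POINT DISTANCE `|x − y|` — lines 1–2 and, at a FIXED Hölder exponent `α`, lines 3–4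
# (Track A, DAG node N15 = NE2, row s3 «King-model rung»; key K3⁷ `SpineGivenEndpointR13SepCoPH` stmt-QuantumFields-20544, helper; FILE 1 of 2,
# the sequel `…N15KingModelCurvedHTorusProp38` packages the four lines as the schema's (3.71) with `α` quantified first)

HONEST FRAMING.  Count-neutral kernel bookkeeping (`--kind proof --supports stmt-QuantumFields-20544 --as helper`; cell `pub-ymgap`, seat
`pub-ymgap-dag-n15-d` g16, on the located successor item (t2″) of the s3 twin `pub-ymgap-dag-n15-e` (PART C `…N15KingModelCurvedHTorus`; its GO
2026-08-28), typed WITHOUT waiting for a re-typed schema).  King's `A = 0` SCALAR MODEL ([King1986], TEMPLATE literature, printed AND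
kernel-proved on Bałaban's tori by the `King1986.Torus.*` chain of seats n18-b ∕ n18-e ∕ n15-e); this file ASSEMBLES those theorems BY NAME
into the letters of the literature schema `King1986.SlicePropagator.TwoSpacing` ∕ (3.71) — a positive control ∕ by-name-ready inhabitant of
N15's most-cited template; NOT [Ba 4] at `A ≠ 0`, NOT Bałaban's covariant `H_k(U)` (NE2⁺ NOT PRINTED, not proved); NOT a node discharge;
K3⁷ OPEN; counts UNMOVED (typed 28∕28 · discharged 5∕27, A 5∕28); finite tori — nothing continuum ∕ ℝ⁴ ∕ OS ∕ mass-gap ∕ Clay.  0 `sorry`,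
standard axioms; the two `def`s are plumbing (PART C's schema datum re-written with the point distance).

THE POINT.  PART C (`N15KingModelRung.Curved.kingTwoSpacing`) packages King's ACTUAL minimisers `ℋ_K`, `ℋ_{K+n}` as the schema's `TwoSpacing`
datum with `dist :=` the unit-BLOCK distance `|B(x) − B(z)|_T` and proves (3.71) LINES 1–2 there, recording as NOT instantiated the Hölder lines
(«`∀ α ∈ (0, 1)` at the fixed outer `γ`, while the tree's `king_prop38_holder_torus_blocks` needs `α + γ ≤ 1`»); and the Hölder quotient
`|x′ − y′|^{−α}` of (3.62) needs the POINT distance of `T_η`, which the block distance cannot carry.  This file: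
* §1 `kingSliceH` ∕ **`kingTwoSpacingH L a m² j n : TwoSpacing (d+1)`** — PART C's datum VERBATIM (same sites, pairing `underPtN`, unit
  points, kernels `K = ℋ_K(·, B(z))`, `K′ = ℋ_{K+n}(·, B(z))`, `dK`, `dK′`) except `dist := holdist` = King's `|x − y|` on `T_η` in
  unit-lattice coordinates (`MinimizerTwoSpacingHolder.holdist`, the currency of the tree's Hölder theorems); the slice kernels `G^η_{(j)}`
  are NOT instantiated (zero, as in PART C: (3.71) does not read them — said; a `Prop37Printed` ∕ `Prop39Printed` statement about this
  datum would be VACUOUS and none is made, here or in the sequel).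
* §2 `holdist_le_blockDist_add_one` (`|x − z| ≤ |B(x) − B(z)|_T + 1`, n15-e's R-a `tdistT_fine_le_blocks`) + `exp_blockDist_le_exp_holdist(_min)`.
* §3 (3.71) LINES 1–2 for this datum (`line1_∕line2_kingTwoSpacingH`): PART C's `kingH_∕dkingH_twoSpacing_le` moved to the point distance by §2.
* §4 (3.71) LINES 3–4 AT A FIXED HÖLDER EXPONENT `α` (`kingH_holder_twoSpacing_le` ∕ `dkingH_holder_twoSpacing_le` in King's terms, then
  `line3_kingTwoSpacingH` ∕ `line4_kingTwoSpacingH` in the schema's letters with `∂_α` = `SlicePropagator.holderDeriv`): for each `0 < α`,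
  `0 < γ`, `α + γ ≤ 1` (resp. `< 1`) ONE `(C, δ)` for ALL volumes `2L^m`, `K ≥ 1`, `n ≥ 1`, unit sites and fine points —
  `King1986.Torus.king_prop38_holder(_deriv)_torus_blocks_unif` (n18-e) with the `(K, n)`-dependence of King's constant removed by
  `N18KingModelScalesPair.fprop38Const_le_unif` ∕ `sqrt_rate_le_unif` BY NAME (the device of PART C's lines 1–2).
HONEST SCOPE.  `A = 0`, King's scalar `ℋ_K` on Bałaban's volumes `2L^m` (odd `L ≥ 3`), one mass `m² > 0` at a time (the `_unif` inputs
at the cap `m₀² = m²`), one-point background sort as in PART C; the coupling `α + γ ≤ 1` of lines 3–4 is King's «for 0 < α < 1, and γ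
sufficiently small» (p. 664) — the schema's quantifier order is discussed in the sequel.  Locators: [King1986] CMP **102** (1986): (2.13)–(2.15)
p. 653, (3.62) p. 663, Prop. 3.8 (3.71) p. 664, §4 pp. 673–674; [Ba 4] = [Balaban1983RegularityDecay] CMP **89** (1983) Thm (1.9)–(1.10) p. 573.
-/

noncomputable section

namespace Summit.QuantumFields.YangMills.BalabanUVNodes.N15.KingModel

open Real Finset
open Literature.MathematicalPhysics.QuantumFieldTheory.Balaban1983to89
open Literature.MathematicalPhysics.QuantumFieldTheory.Balaban1983to89.B5Prop11Plancherel (Tor fine unitVec)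
open Literature.MathematicalPhysics.QuantumFieldTheory.King1986 (aK fprop38RateConst fprop38PosConst lemma43Const aliasConst)
open Literature.MathematicalPhysics.QuantumFieldTheory.King1986.Torus (blockOf blockOf_over tdistT tdistT_nonneg holdist holdist_nonneg
  king_prop38_holder_torus_blocks_unif king_prop38_holder_deriv_torus_blocks_unif)
open Literature.MathematicalPhysics.QuantumFieldTheory.King1986.SlicePropagator (SliceKernels TwoSpacing Prop38Printed holderDeriv)
open Summit.QuantumFields.YangMills.BalabanUVNodes.N18KingModelScalesPair (fprop38Const_le_unif sqrt_rate_le_unif aliasConst_nonneg_of_lt_one)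
open Summit.QuantumFields.YangMills.BalabanUVNodes.N15KingModelRung (KingVolIndex kingVol kingVol_neZero kingVol_eq_sitesPerDir basePt
  kingH dkingH)
open Summit.QuantumFields.YangMills.BalabanUVNodes.N15KingModelRung.Curved (underPtN val_underPtN kingH_twoSpacing_le dkingH_twoSpacing_le
  theta_pow_eq_rpow tdistT_fine_le_blocks)

variable {d : ℕ}

/-! ## §1 King's `A = 0` minimiser at two spacings as the schema's `TwoSpacing` datum WITH THE POINT DISTANCE `|x − y|` -/

section Object

variable (L : ℕ) [NeZero L]

/-- THE SCHEMA's SLICE-DATA RECORD FOR KING'S `A = 0` TORUS at `Nf` fine sites per unit block side (`Nf = L^k`), POINT-DISTANCE EDITION: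
sites `Tor (fine Nf M)`, distance = King's `|x − y|` on `T_η` in unit-lattice coordinates (`holdist`, the sup torus distance of the fine
points over `Nf` — the currency of the Hölder quotient (3.62) and of the tree's `king_prop38_holder_*` theorems), block factor `L`, level
`k`; the slice kernels `G^η_{(j)}`, their gradients, the contour kernels and the bond sort are NOT instantiated (zero ∕ `Unit`, exactly as
in PART C's `kingSlice`: Prop. 3.8 (3.71) does not read them). [cite: King1986, (3.62) p.663 (the distance), p.664 (two-spacing data)] -/
@[reducible] def kingSliceH (Nf : ℕ) [NeZero Nf] (M : Fin (d + 1) → ℕ) [∀ μ, NeZero (M μ)] (k : ℕ) : SliceKernels (d + 1) where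
  S := Tor (fine Nf M)
  B := Unit
  dist := holdist Nf M
  distBlockBond := fun _ _ _ => 0
  L := L
  k := k
  G := fun _ _ _ => 0
  dG := fun _ _ _ _ => 0
  Gc := fun _ _ _ => 0

/-- **KING'S `A = 0` MINIMISER AT TWO SPACINGS AS THE SCHEMA's `TwoSpacing` DATUM, POINT-DISTANCE EDITION** (index `j` = volume `2L^m`
∕ `K` coarse scales, `n` extra scales): PART C's `kingTwoSpacing L a m² j n` VERBATIM — coarse run on `T_η = Tor (fine L^K M)`, fine run on
`T_{η′} = Tor (fine (L^nL^K) M)`, `pt = underPtN` (King's pairing `x_μ = ⌊x′_μ∕L^n⌋`), unit points = base points of unit blocks,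
`K(x, z) = ℋ_K(x, B(z))`, `K′(x′, z) = ℋ_{K+n}(x′, B(z))`, `dK`, `dK′` the lattice derivatives — except that BOTH levels carry the point
distance `holdist`. [cite: King1986, (2.13)–(2.15) p.653, (3.62) p.663, Prop. 3.8 (3.71) p.664 (objects)] -/
@[reducible] def kingTwoSpacingH (a m2 : ℝ) (j : KingVolIndex d) (n : ℕ) : TwoSpacing (d + 1) :=
  haveI := kingVol_neZero L j
  { lo := kingSliceH L (L ^ j.K) (kingVol L j) j.K
    hi := kingSliceH L (L ^ n * L ^ j.K) (kingVol L j) (j.K + n)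
    n := n
    k_hi := rfl
    L_hi := rfl
    pt := underPtN L j.K n (kingVol L j)
    bd := fun b => b
    IsUnit := fun z => z = basePt (L ^ j.K) (kingVol L j) (blockOf (L ^ j.K) (kingVol L j) z)
    K := fun x z => kingH L (L ^ j.K) (kingVol L j) a m2 j.K (blockOf (L ^ j.K) (kingVol L j) z) x
    dK := fun μ x z => dkingH L (L ^ j.K) (kingVol L j) a m2 j.K (blockOf (L ^ j.K) (kingVol L j) z) μ x
    K' := fun x' z => kingH L (L ^ n * L ^ j.K) (kingVol L j) a m2 (j.K + n) (blockOf (L ^ j.K) (kingVol L j) z) x'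
    dK' := fun μ x' z => dkingH L (L ^ n * L ^ j.K) (kingVol L j) a m2 (j.K + n) (blockOf (L ^ j.K) (kingVol L j) z) μ x' }

end Object

/-! ## §2 Point distance versus block distance: `|x − z| ≤ |B(x) − B(z)|_T + 1` -/

section Distances

variable (N : ℕ) [NeZero N] (M : Fin (d + 1) → ℕ) [∀ μ, NeZero (M μ)]

/-- **`|x − z| ≤ |B(x) − B(z)|_T + 1`**: King's point distance on `T_η` (unit coordinates) exceeds the unit-block distance by at most one
block (n15-e's `tdistT_fine_le_blocks`: `|x − z|_{fine} ≤ N·|B(x) − B(z)|_T + (N − 1)`). [folklore] -/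
theorem holdist_le_blockDist_add_one (x z : Tor (fine N M)) :
    holdist N M x z ≤ tdistT M (blockOf N M x) (blockOf N M z) + 1 := by
  have hN : (0 : ℝ) < N := by exact_mod_cast Nat.pos_of_ne_zero (NeZero.ne N)
  have h := tdistT_fine_le_blocks N M x z
  unfold holdist
  rw [div_le_iff₀ hN]
  nlinarith [tdistT_nonneg M (blockOf N M x) (blockOf N M z)]

/-- **Block decay is point decay up to the factor `e^{δ}`**: `e^{−δ|B(x) − B(z)|_T} ≤ e^{δ}·e^{−δ|x − z|}` (`δ ≥ 0`). [folklore] -/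
theorem exp_blockDist_le_exp_holdist {δ : ℝ} (hδ : 0 ≤ δ) (x z : Tor (fine N M)) :
    Real.exp (-(δ * tdistT M (blockOf N M x) (blockOf N M z))) ≤ Real.exp δ * Real.exp (-(δ * holdist N M x z)) := by
  rw [← Real.exp_add]
  refine Real.exp_le_exp.mpr ?_
  have h := holdist_le_blockDist_add_one N M x z
  nlinarith

/-- The same for the two-point decay of the Hölder lines, `b = B(z)`: `exp(−δ·min(|B(x) − b|, |B(y) − b|)) ≤ e^{δ}·exp(−δ·min(|x − z|, |y − z|))`. [folklore] -/
theorem exp_blockDist_min_le_exp_holdist_min {δ : ℝ} (hδ : 0 ≤ δ) (x y z : Tor (fine N M)) :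
    Real.exp (-(δ * min (tdistT M (blockOf N M x) (blockOf N M z)) (tdistT M (blockOf N M y) (blockOf N M z))))
      ≤ Real.exp δ * Real.exp (-(δ * min (holdist N M x z) (holdist N M y z))) := by
  rw [← Real.exp_add]
  refine Real.exp_le_exp.mpr ?_
  have hx := holdist_le_blockDist_add_one N M x z
  have hy := holdist_le_blockDist_add_one N M y z
  have hmin : min (holdist N M x z) (holdist N M y z)
      ≤ min (tdistT M (blockOf N M x) (blockOf N M z)) (tdistT M (blockOf N M y) (blockOf N M z)) + 1 := by
    rw [← min_add_add_right]
    exact min_le_min hx hy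
  nlinarith

end Distances

/-! ## §3 (3.71) lines 1–2 for the point-distance datum, every `n ≥ 1`: one constant for all volumes, levels and spacing ratios -/

section Lines12

variable (L : ℕ) [NeZero L]

/-- **(3.71) LINE 1 IN THE SCHEMA's LETTERS FOR THE POINT-DISTANCE DATUM, EVERY `n ≥ 1`** (odd `L ≥ 3`, `a, m² > 0`, `0 ≤ γ ≤ 1`): ONE
`(C, δ)` with `|K′(x′, z) − K(pt x′, z)| ≤ C·L^{−(γ∕2)K}·e^{−δ·|pt x′ − z|}` on `kingTwoSpacingH L a m² j n` for every index `j`, `n ≥ 1`,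
fine `x′` and every `z` (the unit-point guard is not needed) — PART C's `kingH_twoSpacing_le` (block decay) and §2. [cite: King1986, Prop. 3.8 (3.71) p.664 (first line)] -/
theorem line1_kingTwoSpacingH (hLodd : Odd L) (hL : 2 ≤ L) {a m2 : ℝ} (ha : 0 < a) (hm : 0 < m2) {γ : ℝ} (hγ0 : 0 ≤ γ)
    (hγ1 : γ ≤ 1) :
    ∃ C δ : ℝ, 0 < C ∧ 0 < δ ∧ ∀ (j : KingVolIndex d) (n : ℕ) (_hn : 1 ≤ n)
      (x' : (kingTwoSpacingH L a m2 j n).hi.S) (z : (kingTwoSpacingH L a m2 j n).lo.S),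
      |(kingTwoSpacingH L a m2 j n).K' x' z - (kingTwoSpacingH L a m2 j n).K ((kingTwoSpacingH L a m2 j n).pt x') z|
        ≤ C * ((kingTwoSpacingH L a m2 j n).lo.L : ℝ) ^ (-(γ / 2 * (kingTwoSpacingH L a m2 j n).lo.k))
          * Real.exp (-(δ * (kingTwoSpacingH L a m2 j n).lo.dist ((kingTwoSpacingH L a m2 j n).pt x') z)) := by
  obtain ⟨C, δ, hC, hδ, H⟩ := kingH_twoSpacing_le (d := d) L hLodd hL ha hm hγ0 hγ1
  refine ⟨C * Real.exp δ, δ, by positivity, hδ, fun j n hn x' z => ?_⟩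
  haveI := kingVol_neZero L j
  have h := H j n hn (blockOf (L ^ j.K) (kingVol L j) z) x'
  rw [theta_pow_eq_rpow] at h
  have hcmp := exp_blockDist_le_exp_holdist (L ^ j.K) (kingVol L j) hδ.le (underPtN L j.K n (kingVol L j) x') z
  have hr : 0 ≤ (L : ℝ) ^ (-(γ / 2 * (j.K : ℝ))) := Real.rpow_nonneg (Nat.cast_nonneg _) _
  calc _ ≤ C * Real.exp (-(δ * tdistT (kingVol L j) (blockOf (L ^ j.K) (kingVol L j) (underPtN L j.K n (kingVol L j) x'))
            (blockOf (L ^ j.K) (kingVol L j) z))) * (L : ℝ) ^ (-(γ / 2 * (j.K : ℝ))) := h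
    _ ≤ C * (Real.exp δ * Real.exp (-(δ * holdist (L ^ j.K) (kingVol L j) (underPtN L j.K n (kingVol L j) x') z)))
          * (L : ℝ) ^ (-(γ / 2 * (j.K : ℝ))) :=
        mul_le_mul_of_nonneg_right (mul_le_mul_of_nonneg_left hcmp hC.le) hr
    _ = _ := by
        show _ = C * Real.exp δ * (L : ℝ) ^ (-(γ / 2 * (j.K : ℝ)))
          * Real.exp (-(δ * holdist (L ^ j.K) (kingVol L j) (underPtN L j.K n (kingVol L j) x') z))
        ring

/-- **(3.71) LINE 2 IN THE SCHEMA's LETTERS FOR THE POINT-DISTANCE DATUM, EVERY `n ≥ 1`** (`0 ≤ γ < 1`): ONE `(C, δ)` with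
`|dK′_μ(x′, z) − dK_μ(pt x′, z)| ≤ C·L^{−(γ∕2)K}·e^{−δ·|pt x′ − z|}` for every index, `n ≥ 1`, direction, fine `x′`, `z` — PART C's
`dkingH_twoSpacing_le` and §2. [cite: King1986, Prop. 3.8 (3.71) p.664 (second line)] -/
theorem line2_kingTwoSpacingH (hLodd : Odd L) (hL : 2 ≤ L) {a m2 : ℝ} (ha : 0 < a) (hm : 0 < m2) {γ : ℝ} (hγ0 : 0 ≤ γ)
    (hγ1 : γ < 1) :
    ∃ C δ : ℝ, 0 < C ∧ 0 < δ ∧ ∀ (j : KingVolIndex d) (n : ℕ) (_hn : 1 ≤ n)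
      (x' : (kingTwoSpacingH L a m2 j n).hi.S) (z : (kingTwoSpacingH L a m2 j n).lo.S) (μ : Fin (d + 1)),
      |(kingTwoSpacingH L a m2 j n).dK' μ x' z - (kingTwoSpacingH L a m2 j n).dK μ ((kingTwoSpacingH L a m2 j n).pt x') z|
        ≤ C * ((kingTwoSpacingH L a m2 j n).lo.L : ℝ) ^ (-(γ / 2 * (kingTwoSpacingH L a m2 j n).lo.k))
          * Real.exp (-(δ * (kingTwoSpacingH L a m2 j n).lo.dist ((kingTwoSpacingH L a m2 j n).pt x') z)) := by
  obtain ⟨C, δ, hC, hδ, H⟩ := dkingH_twoSpacing_le (d := d) L hLodd hL ha hm hγ0 hγ1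
  refine ⟨C * Real.exp δ, δ, by positivity, hδ, fun j n hn x' z μ => ?_⟩
  haveI := kingVol_neZero L j
  have h := H j n hn (blockOf (L ^ j.K) (kingVol L j) z) μ x'
  rw [theta_pow_eq_rpow] at h
  have hcmp := exp_blockDist_le_exp_holdist (L ^ j.K) (kingVol L j) hδ.le (underPtN L j.K n (kingVol L j) x') z
  have hr : 0 ≤ (L : ℝ) ^ (-(γ / 2 * (j.K : ℝ))) := Real.rpow_nonneg (Nat.cast_nonneg _) _
  calc _ ≤ C * Real.exp (-(δ * tdistT (kingVol L j) (blockOf (L ^ j.K) (kingVol L j) (underPtN L j.K n (kingVol L j) x'))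
            (blockOf (L ^ j.K) (kingVol L j) z))) * (L : ℝ) ^ (-(γ / 2 * (j.K : ℝ))) := h
    _ ≤ C * (Real.exp δ * Real.exp (-(δ * holdist (L ^ j.K) (kingVol L j) (underPtN L j.K n (kingVol L j) x') z)))
          * (L : ℝ) ^ (-(γ / 2 * (j.K : ℝ))) :=
        mul_le_mul_of_nonneg_right (mul_le_mul_of_nonneg_left hcmp hC.le) hr
    _ = _ := by
        show _ = C * Real.exp δ * (L : ℝ) ^ (-(γ / 2 * (j.K : ℝ)))
          * Real.exp (-(δ * holdist (L ^ j.K) (kingVol L j) (underPtN L j.K n (kingVol L j) x') z))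
        ring

end Lines12

/-! ## §4 (3.71) lines 3–4 at a fixed Hölder exponent `α`: one constant for all volumes, levels and spacing ratios -/

section Lines34

variable (L : ℕ) [NeZero L]

/-- **THE TWO-SPACING RATE OF THE HÖLDER QUOTIENT OF KING'S MINIMISER, EVERY `n ≥ 1`, UNIFORMLY** — (3.71) line 3 at a FIXED `α`: for
odd `L ≥ 3`, `a > 0`, `m² > 0`, `0 < α`, `0 < γ`, `α + γ ≤ 1` there are `C, δ > 0` (functions of `d, L, a, m², α, γ`) with
`||x′ − y′|^{−α}(ℋ_{K+n}(x′, b) − ℋ_{K+n}(y′, b)) − |x − y|^{−α}(ℋ_K(x, b) − ℋ_K(y, b))| ≤ C·e^{−δ·min(|B(x) − b|_T, |B(y) − b|_T)}·(L^{−γ∕2})^K`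
for EVERY volume `2L^m`, `K ≥ 1`, `n ≥ 1`, unit site `b`, fine points `x′, y′` (`x, y` under them) — the tree's
`King1986.Torus.king_prop38_holder_torus_blocks_unif` (at the mass cap `m₀² = m²`) at general `n`, its constant majorised uniformly in
`(K, n)` by `N18KingModelScalesPair.fprop38Const_le_unif` ∕ `sqrt_rate_le_unif`. [cite: King1986, Prop. 3.8 (3.71) p.664 (third line), (4.27)–(4.31) pp.673–674] -/
theorem kingH_holder_twoSpacing_le (hLodd : Odd L) (hL : 2 ≤ L) {a m2 : ℝ} (ha : 0 < a) (hm : 0 < m2) {α γ : ℝ} (hα : 0 < α)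
    (hγ : 0 < γ) (hαγ : α + γ ≤ 1) :
    ∃ C δ : ℝ, 0 < C ∧ 0 < δ ∧ ∀ (j : KingVolIndex d) (n : ℕ) (_hn : 1 ≤ n) (b : Tor (kingVol L j))
      (x' y' : Tor (fine (L ^ n * L ^ j.K) (kingVol L j))),
      haveI := kingVol_neZero L j
      |(holdist (L ^ n * L ^ j.K) (kingVol L j) x' y') ^ (-α)
          * (kingH L (L ^ n * L ^ j.K) (kingVol L j) a m2 (j.K + n) b x' - kingH L (L ^ n * L ^ j.K) (kingVol L j) a m2 (j.K + n) b y')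
        - (holdist (L ^ j.K) (kingVol L j) (underPtN L j.K n (kingVol L j) x') (underPtN L j.K n (kingVol L j) y')) ^ (-α)
          * (kingH L (L ^ j.K) (kingVol L j) a m2 j.K b (underPtN L j.K n (kingVol L j) x')
            - kingH L (L ^ j.K) (kingVol L j) a m2 j.K b (underPtN L j.K n (kingVol L j) y'))|
        ≤ C * Real.exp (-(δ * min (tdistT (kingVol L j) (blockOf (L ^ j.K) (kingVol L j) (underPtN L j.K n (kingVol L j) x')) b)
            (tdistT (kingVol L j) (blockOf (L ^ j.K) (kingVol L j) (underPtN L j.K n (kingVol L j) y')) b)))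
          * (((L : ℝ) ^ (-(γ / 2))) ^ j.K) := by
  obtain ⟨δ₀, c₀, hδ₀, hc₀, H⟩ :=
    king_prop38_holder_torus_blocks_unif (d + 1) L (Nat.succ_pos d) hLodd hL ha hm.le hα hγ hαγ
  set Cu : ℝ := fprop38RateConst a a (a * (2 * ((a * (1 - ((L : ℝ) ^ 2)⁻¹))⁻¹ + π ^ 2 / 48 + 1 / 3)))
      ((π ^ 2 / 4) ^ (d + 1)) (d + 1) γ α (2 * ((d + 1 : ℕ) : ℝ) ^ α) 0
    + fprop38PosConst a ((π ^ 2 / 4) ^ (d + 1)) (d + 1) γ α (2 * ((d + 1 : ℕ) : ℝ) ^ α) (6 * ((d + 1 : ℕ) : ℝ) ^ (α + γ))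
    with hCu
  refine ⟨Real.sqrt (2 * c₀ * Cu) + 1, δ₀ / 2, by positivity, half_pos hδ₀, fun j n hn b x' y' => ?_⟩
  haveI := kingVol_neZero L j
  have hj := H (j.params L hLodd hL) rfl rfl j.one_le_K m2 hm le_rfl n hn (kingVol L j) (kingVol_eq_sitesPerDir L hLodd hL j)
    (underPtN L j.K n (kingVol L j) x') (underPtN L j.K n (kingVol L j) y') x' y' b
    (val_underPtN L j.K n (kingVol L j) x') (val_underPtN L j.K n (kingVol L j) y')
  set s : ℝ := (L : ℝ) ^ (-(γ / 2)) with hs_def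
  have hs : 0 ≤ s := Real.rpow_nonneg (Nat.cast_nonneg _) _
  set E : ℝ := Real.exp (-(δ₀ / 2 * min (tdistT (kingVol L j) (blockOf (L ^ j.K) (kingVol L j) (underPtN L j.K n (kingVol L j) x')) b)
      (tdistT (kingVol L j) (blockOf (L ^ j.K) (kingVol L j) (underPtN L j.K n (kingVol L j) y')) b))) with hE
  set Ck : ℝ := fprop38RateConst a a (lemma43Const a L j.K n) ((π ^ 2 / 4) ^ (d + 1)) (d + 1) γ α (2 * ((d + 1 : ℕ) : ℝ) ^ α) 0
    + fprop38PosConst a ((π ^ 2 / 4) ^ (d + 1)) (d + 1) γ α (2 * ((d + 1 : ℕ) : ℝ) ^ α) (6 * ((d + 1 : ℕ) : ℝ) ^ (α + γ))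
    with hCk
  have hstep : |(holdist (L ^ n * L ^ j.K) (kingVol L j) x' y') ^ (-α)
          * (kingH L (L ^ n * L ^ j.K) (kingVol L j) a m2 (j.K + n) b x' - kingH L (L ^ n * L ^ j.K) (kingVol L j) a m2 (j.K + n) b y')
        - (holdist (L ^ j.K) (kingVol L j) (underPtN L j.K n (kingVol L j) x') (underPtN L j.K n (kingVol L j) y')) ^ (-α)
          * (kingH L (L ^ j.K) (kingVol L j) a m2 j.K b (underPtN L j.K n (kingVol L j) x')
            - kingH L (L ^ j.K) (kingVol L j) a m2 j.K b (underPtN L j.K n (kingVol L j) y'))|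
      ≤ Real.sqrt (Ck * ((L ^ j.K : ℕ) : ℝ) ^ (-γ) * (2 * c₀)) * E := hj
  have hAC : 0 ≤ aliasConst (d + 1) (α + γ - 1) := aliasConst_nonneg_of_lt_one (d := d + 1) (Nat.succ_pos d) (by linarith)
  have hCle : Ck ≤ Cu := fprop38Const_le_unif (d := d + 1) ha hL j.one_le_K hn (V := (π ^ 2 / 4) ^ (d + 1)) (γ := γ) (β := α)
    (cE := 2 * ((d + 1 : ℕ) : ℝ) ^ α) (rE := 0) (sE := 6 * ((d + 1 : ℕ) : ℝ) ^ (α + γ)) (by positivity) (by positivity) hAC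
  have hC := sqrt_rate_le_unif hCle (by positivity : (0 : ℝ) ≤ 2 * c₀) L j.K γ
  calc _ ≤ Real.sqrt (Ck * ((L ^ j.K : ℕ) : ℝ) ^ (-γ) * (2 * c₀)) * E := hstep
    _ ≤ Real.sqrt (2 * c₀ * Cu) * s ^ j.K * E := mul_le_mul_of_nonneg_right hC (Real.exp_pos _).le
    _ ≤ (Real.sqrt (2 * c₀ * Cu) + 1) * s ^ j.K * E := by
        refine mul_le_mul_of_nonneg_right (mul_le_mul_of_nonneg_right (by linarith) (pow_nonneg hs _)) (Real.exp_pos _).le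
    _ = (Real.sqrt (2 * c₀ * Cu) + 1) * E * s ^ j.K := by ring

/-- **THE TWO-SPACING RATE OF THE HÖLDER QUOTIENT OF THE DERIVATIVE, EVERY `n ≥ 1`, UNIFORMLY** — (3.71) line 4 at a FIXED `α`
(`0 < α`, `0 < γ`, `α + γ < 1`): ONE `(C, δ)` with
`||x′ − y′|^{−α}(∂^{η′}_μℋ_{K+n}(x′, b) − ∂^{η′}_μℋ_{K+n}(y′, b)) − |x − y|^{−α}(∂^η_μℋ_K(x, b) − ∂^η_μℋ_K(y, b))|
≤ C·e^{−δ·min(|B(x) − b|_T, |B(y) − b|_T)}·(L^{−γ∕2})^K` for every volume, `K ≥ 1`, `n ≥ 1`, `b`, `μ`, `x′, y′` —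
`king_prop38_holder_deriv_torus_blocks_unif` + `fprop38Const_le_unif` ∕ `sqrt_rate_le_unif`. [cite: King1986, Prop. 3.8 (3.71) p.664 (fourth line), (4.27)–(4.31) pp.673–674] -/
theorem dkingH_holder_twoSpacing_le (hLodd : Odd L) (hL : 2 ≤ L) {a m2 : ℝ} (ha : 0 < a) (hm : 0 < m2) {α γ : ℝ} (hα : 0 < α)
    (hγ : 0 < γ) (hαγ : α + γ < 1) :
    ∃ C δ : ℝ, 0 < C ∧ 0 < δ ∧ ∀ (j : KingVolIndex d) (n : ℕ) (_hn : 1 ≤ n) (b : Tor (kingVol L j)) (μ : Fin (d + 1))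
      (x' y' : Tor (fine (L ^ n * L ^ j.K) (kingVol L j))),
      haveI := kingVol_neZero L j
      |(holdist (L ^ n * L ^ j.K) (kingVol L j) x' y') ^ (-α)
          * (dkingH L (L ^ n * L ^ j.K) (kingVol L j) a m2 (j.K + n) b μ x' - dkingH L (L ^ n * L ^ j.K) (kingVol L j) a m2 (j.K + n) b μ y')
        - (holdist (L ^ j.K) (kingVol L j) (underPtN L j.K n (kingVol L j) x') (underPtN L j.K n (kingVol L j) y')) ^ (-α)
          * (dkingH L (L ^ j.K) (kingVol L j) a m2 j.K b μ (underPtN L j.K n (kingVol L j) x')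
            - dkingH L (L ^ j.K) (kingVol L j) a m2 j.K b μ (underPtN L j.K n (kingVol L j) y'))|
        ≤ C * Real.exp (-(δ * min (tdistT (kingVol L j) (blockOf (L ^ j.K) (kingVol L j) (underPtN L j.K n (kingVol L j) x')) b)
            (tdistT (kingVol L j) (blockOf (L ^ j.K) (kingVol L j) (underPtN L j.K n (kingVol L j) y')) b)))
          * (((L : ℝ) ^ (-(γ / 2))) ^ j.K) := by
  obtain ⟨δ₀, c₀, hδ₀, hc₀, H⟩ :=
    king_prop38_holder_deriv_torus_blocks_unif (d + 1) L (Nat.succ_pos d) hLodd hL ha hm.le hα hγ hαγ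
  set Cu : ℝ := fprop38RateConst a a (a * (2 * ((a * (1 - ((L : ℝ) ^ 2)⁻¹))⁻¹ + π ^ 2 / 48 + 1 / 3)))
      ((π ^ 2 / 4) ^ (d + 1)) (d + 1) γ (α + 1) (2 * ((d + 1 : ℕ) : ℝ) ^ α) (2 * ((d + 1 : ℕ) : ℝ) ^ α * 2 ^ (1 - γ))
    + fprop38PosConst a ((π ^ 2 / 4) ^ (d + 1)) (d + 1) γ (α + 1) (2 * ((d + 1 : ℕ) : ℝ) ^ α) (6 * ((d + 1 : ℕ) : ℝ) ^ (α + γ))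
    with hCu
  refine ⟨Real.sqrt (2 * c₀ * Cu) + 1, δ₀ / 2, by positivity, half_pos hδ₀, fun j n hn b μ x' y' => ?_⟩
  haveI := kingVol_neZero L j
  have hj := H (j.params L hLodd hL) rfl rfl j.one_le_K m2 hm le_rfl n hn (kingVol L j) (kingVol_eq_sitesPerDir L hLodd hL j)
    (underPtN L j.K n (kingVol L j) x') (underPtN L j.K n (kingVol L j) y') x' y' b
    (val_underPtN L j.K n (kingVol L j) x') (val_underPtN L j.K n (kingVol L j) y') μ
  set s : ℝ := (L : ℝ) ^ (-(γ / 2)) with hs_def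
  have hs : 0 ≤ s := Real.rpow_nonneg (Nat.cast_nonneg _) _
  set E : ℝ := Real.exp (-(δ₀ / 2 * min (tdistT (kingVol L j) (blockOf (L ^ j.K) (kingVol L j) (underPtN L j.K n (kingVol L j) x')) b)
      (tdistT (kingVol L j) (blockOf (L ^ j.K) (kingVol L j) (underPtN L j.K n (kingVol L j) y')) b))) with hE
  set Ck : ℝ := fprop38RateConst a a (lemma43Const a L j.K n) ((π ^ 2 / 4) ^ (d + 1)) (d + 1) γ (α + 1) (2 * ((d + 1 : ℕ) : ℝ) ^ α)
      (2 * ((d + 1 : ℕ) : ℝ) ^ α * 2 ^ (1 - γ))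
    + fprop38PosConst a ((π ^ 2 / 4) ^ (d + 1)) (d + 1) γ (α + 1) (2 * ((d + 1 : ℕ) : ℝ) ^ α) (6 * ((d + 1 : ℕ) : ℝ) ^ (α + γ))
    with hCk
  have hstep : |(holdist (L ^ n * L ^ j.K) (kingVol L j) x' y') ^ (-α)
          * (dkingH L (L ^ n * L ^ j.K) (kingVol L j) a m2 (j.K + n) b μ x' - dkingH L (L ^ n * L ^ j.K) (kingVol L j) a m2 (j.K + n) b μ y')
        - (holdist (L ^ j.K) (kingVol L j) (underPtN L j.K n (kingVol L j) x') (underPtN L j.K n (kingVol L j) y')) ^ (-α)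
          * (dkingH L (L ^ j.K) (kingVol L j) a m2 j.K b μ (underPtN L j.K n (kingVol L j) x')
            - dkingH L (L ^ j.K) (kingVol L j) a m2 j.K b μ (underPtN L j.K n (kingVol L j) y'))|
      ≤ Real.sqrt (Ck * ((L ^ j.K : ℕ) : ℝ) ^ (-γ) * (2 * c₀)) * E := hj
  have hAC : 0 ≤ aliasConst (d + 1) (α + 1 + γ - 1) := by
    rw [show α + 1 + γ - 1 = α + γ by ring]
    exact aliasConst_nonneg_of_lt_one (d := d + 1) (Nat.succ_pos d) hαγ
  have hCle : Ck ≤ Cu := fprop38Const_le_unif (d := d + 1) ha hL j.one_le_K hn (V := (π ^ 2 / 4) ^ (d + 1)) (γ := γ) (β := α + 1)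
    (cE := 2 * ((d + 1 : ℕ) : ℝ) ^ α) (rE := 2 * ((d + 1 : ℕ) : ℝ) ^ α * 2 ^ (1 - γ)) (sE := 6 * ((d + 1 : ℕ) : ℝ) ^ (α + γ))
    (by positivity) (by positivity) hAC
  have hC := sqrt_rate_le_unif hCle (by positivity : (0 : ℝ) ≤ 2 * c₀) L j.K γ
  calc _ ≤ Real.sqrt (Ck * ((L ^ j.K : ℕ) : ℝ) ^ (-γ) * (2 * c₀)) * E := hstep
    _ ≤ Real.sqrt (2 * c₀ * Cu) * s ^ j.K * E := mul_le_mul_of_nonneg_right hC (Real.exp_pos _).le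
    _ ≤ (Real.sqrt (2 * c₀ * Cu) + 1) * s ^ j.K * E := by
        refine mul_le_mul_of_nonneg_right (mul_le_mul_of_nonneg_right (by linarith) (pow_nonneg hs _)) (Real.exp_pos _).le
    _ = (Real.sqrt (2 * c₀ * Cu) + 1) * E * s ^ j.K := by ring

/-- **(3.71) LINE 3 IN THE SCHEMA's LETTERS FOR THE POINT-DISTANCE DATUM AT A FIXED `α`, EVERY `n ≥ 1`** (`0 < α`, `0 < γ`, `α + γ ≤ 1`):
ONE `(C, δ)` with `|∂_α(x′, y′)K′(z) − ∂_α(pt x′, pt y′)K(z)| ≤ C·L^{−(γ∕2)K}·e^{−δ·min(|pt x′ − z|, |pt y′ − z|)}` on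
`kingTwoSpacingH L a m² j n`, for every `j`, `n ≥ 1`, fine `x′, y′` and every `z` (`∂_α` = the schema's `holderDeriv` (3.62); no guard on
`x′ ≠ y′` or on `z` is needed) — `kingH_holder_twoSpacing_le` and §2. [cite: King1986, (3.62) p.663, Prop. 3.8 (3.71) p.664 (third line)] -/
theorem line3_kingTwoSpacingH (hLodd : Odd L) (hL : 2 ≤ L) {a m2 : ℝ} (ha : 0 < a) (hm : 0 < m2) {α γ : ℝ} (hα : 0 < α)
    (hγ : 0 < γ) (hαγ : α + γ ≤ 1) :
    ∃ C δ : ℝ, 0 < C ∧ 0 < δ ∧ ∀ (j : KingVolIndex d) (n : ℕ) (_hn : 1 ≤ n)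
      (x' y' : (kingTwoSpacingH L a m2 j n).hi.S) (z : (kingTwoSpacingH L a m2 j n).lo.S),
      |holderDeriv (kingTwoSpacingH L a m2 j n).hi.dist α (kingTwoSpacingH L a m2 j n).K' x' y' z
          - holderDeriv (kingTwoSpacingH L a m2 j n).lo.dist α (kingTwoSpacingH L a m2 j n).K
              ((kingTwoSpacingH L a m2 j n).pt x') ((kingTwoSpacingH L a m2 j n).pt y') z|
        ≤ C * ((kingTwoSpacingH L a m2 j n).lo.L : ℝ) ^ (-(γ / 2 * (kingTwoSpacingH L a m2 j n).lo.k))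
          * Real.exp (-(δ * min ((kingTwoSpacingH L a m2 j n).lo.dist ((kingTwoSpacingH L a m2 j n).pt x') z)
              ((kingTwoSpacingH L a m2 j n).lo.dist ((kingTwoSpacingH L a m2 j n).pt y') z))) := by
  obtain ⟨C, δ, hC, hδ, H⟩ := kingH_holder_twoSpacing_le (d := d) L hLodd hL ha hm hα hγ hαγ
  refine ⟨C * Real.exp δ, δ, by positivity, hδ, fun j n hn x' y' z => ?_⟩
  haveI := kingVol_neZero L j
  have h := H j n hn (blockOf (L ^ j.K) (kingVol L j) z) x' y'
  rw [theta_pow_eq_rpow] at h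
  have hcmp := exp_blockDist_min_le_exp_holdist_min (L ^ j.K) (kingVol L j) hδ.le (underPtN L j.K n (kingVol L j) x')
    (underPtN L j.K n (kingVol L j) y') z
  have hr : 0 ≤ (L : ℝ) ^ (-(γ / 2 * (j.K : ℝ))) := Real.rpow_nonneg (Nat.cast_nonneg _) _
  unfold holderDeriv
  calc _ ≤ C * Real.exp (-(δ * min (tdistT (kingVol L j) (blockOf (L ^ j.K) (kingVol L j) (underPtN L j.K n (kingVol L j) x'))
              (blockOf (L ^ j.K) (kingVol L j) z))
            (tdistT (kingVol L j) (blockOf (L ^ j.K) (kingVol L j) (underPtN L j.K n (kingVol L j) y')) (blockOf (L ^ j.K) (kingVol L j) z))))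
          * (L : ℝ) ^ (-(γ / 2 * (j.K : ℝ))) := h
    _ ≤ C * (Real.exp δ * Real.exp (-(δ * min (holdist (L ^ j.K) (kingVol L j) (underPtN L j.K n (kingVol L j) x') z)
            (holdist (L ^ j.K) (kingVol L j) (underPtN L j.K n (kingVol L j) y') z)))) * (L : ℝ) ^ (-(γ / 2 * (j.K : ℝ))) :=
        mul_le_mul_of_nonneg_right (mul_le_mul_of_nonneg_left hcmp hC.le) hr
    _ = _ := by
        show _ = C * Real.exp δ * (L : ℝ) ^ (-(γ / 2 * (j.K : ℝ)))
          * Real.exp (-(δ * min (holdist (L ^ j.K) (kingVol L j) (underPtN L j.K n (kingVol L j) x') z)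
            (holdist (L ^ j.K) (kingVol L j) (underPtN L j.K n (kingVol L j) y') z)))
        ring

/-- **(3.71) LINE 4 IN THE SCHEMA's LETTERS FOR THE POINT-DISTANCE DATUM AT A FIXED `α`, EVERY `n ≥ 1`** (`0 < α`, `0 < γ`, `α + γ < 1`):
ONE `(C, δ)` with `|∂_α(x′, y′)dK′_μ(z) − ∂_α(pt x′, pt y′)dK_μ(z)| ≤ C·L^{−(γ∕2)K}·e^{−δ·min(|pt x′ − z|, |pt y′ − z|)}` for every `j`,
`n ≥ 1`, `μ`, fine `x′, y′`, `z` — `dkingH_holder_twoSpacing_le` and §2. [cite: King1986, (3.62) p.663, Prop. 3.8 (3.71) p.664 (fourth line)] -/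
theorem line4_kingTwoSpacingH (hLodd : Odd L) (hL : 2 ≤ L) {a m2 : ℝ} (ha : 0 < a) (hm : 0 < m2) {α γ : ℝ} (hα : 0 < α)
    (hγ : 0 < γ) (hαγ : α + γ < 1) :
    ∃ C δ : ℝ, 0 < C ∧ 0 < δ ∧ ∀ (j : KingVolIndex d) (n : ℕ) (_hn : 1 ≤ n)
      (x' y' : (kingTwoSpacingH L a m2 j n).hi.S) (z : (kingTwoSpacingH L a m2 j n).lo.S) (μ : Fin (d + 1)),
      |holderDeriv (kingTwoSpacingH L a m2 j n).hi.dist α ((kingTwoSpacingH L a m2 j n).dK' μ) x' y' z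
          - holderDeriv (kingTwoSpacingH L a m2 j n).lo.dist α ((kingTwoSpacingH L a m2 j n).dK μ)
              ((kingTwoSpacingH L a m2 j n).pt x') ((kingTwoSpacingH L a m2 j n).pt y') z|
        ≤ C * ((kingTwoSpacingH L a m2 j n).lo.L : ℝ) ^ (-(γ / 2 * (kingTwoSpacingH L a m2 j n).lo.k))
          * Real.exp (-(δ * min ((kingTwoSpacingH L a m2 j n).lo.dist ((kingTwoSpacingH L a m2 j n).pt x') z)
              ((kingTwoSpacingH L a m2 j n).lo.dist ((kingTwoSpacingH L a m2 j n).pt y') z))) := by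
  obtain ⟨C, δ, hC, hδ, H⟩ := dkingH_holder_twoSpacing_le (d := d) L hLodd hL ha hm hα hγ hαγ
  refine ⟨C * Real.exp δ, δ, by positivity, hδ, fun j n hn x' y' z μ => ?_⟩
  haveI := kingVol_neZero L j
  have h := H j n hn (blockOf (L ^ j.K) (kingVol L j) z) μ x' y'
  rw [theta_pow_eq_rpow] at h
  have hcmp := exp_blockDist_min_le_exp_holdist_min (L ^ j.K) (kingVol L j) hδ.le (underPtN L j.K n (kingVol L j) x')
    (underPtN L j.K n (kingVol L j) y') z
  have hr : 0 ≤ (L : ℝ) ^ (-(γ / 2 * (j.K : ℝ))) := Real.rpow_nonneg (Nat.cast_nonneg _) _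
  unfold holderDeriv
  calc _ ≤ C * Real.exp (-(δ * min (tdistT (kingVol L j) (blockOf (L ^ j.K) (kingVol L j) (underPtN L j.K n (kingVol L j) x'))
              (blockOf (L ^ j.K) (kingVol L j) z))
            (tdistT (kingVol L j) (blockOf (L ^ j.K) (kingVol L j) (underPtN L j.K n (kingVol L j) y')) (blockOf (L ^ j.K) (kingVol L j) z))))
          * (L : ℝ) ^ (-(γ / 2 * (j.K : ℝ))) := h
    _ ≤ C * (Real.exp δ * Real.exp (-(δ * min (holdist (L ^ j.K) (kingVol L j) (underPtN L j.K n (kingVol L j) x') z)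
            (holdist (L ^ j.K) (kingVol L j) (underPtN L j.K n (kingVol L j) y') z)))) * (L : ℝ) ^ (-(γ / 2 * (j.K : ℝ))) :=
        mul_le_mul_of_nonneg_right (mul_le_mul_of_nonneg_left hcmp hC.le) hr
    _ = _ := by
        show _ = C * Real.exp δ * (L : ℝ) ^ (-(γ / 2 * (j.K : ℝ)))
          * Real.exp (-(δ * min (holdist (L ^ j.K) (kingVol L j) (underPtN L j.K n (kingVol L j) x') z)
            (holdist (L ^ j.K) (kingVol L j) (underPtN L j.K n (kingVol L j) y') z)))
        ring

end Lines34

end Summit.QuantumFields.YangMills.BalabanUVNodes.N15.KingModel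

end
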